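import Summits.Ventures.YMGap.Thresholds.DSWindowCertificate
import Literature.MathematicalPhysics.QuantumFieldTheory.Balaban1983to89.StrongCouplingTorusWindow
import HarnessLib

/-!
# Venture YMGap — track (c) «DS»: the Dobrushin–Shlosman window certificate in LATTICE-GAUGE
# language (cells = links of the torus, windows = finite sets of links) and the doors it opens

HONEST FRAMING: venture file (cell `pub-ymgap`, QuantumFields programme), strong-coupling LATTICE
bookkeeping only (currency SC-a: exponential clustering of local observables of a lattice gauge
measure on a finite torus, constants uniform in the volume). Continues `DSWindowCertificate.lean`
(the abstract certificate `DSWindow.Certificate` = EXACTLY the specification-side hypotheses of the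
tree's PROVED `DobrushinShlosman.abs_covariance_le`): here the same dictionary is written out for
the torus weight specification `torusWeightSpec v` of a positive continuous plaquette weight `v` on
the links of `(ℤ/L)^d` (`PlaquetteWeightTorusSpecification.lean`; Wilson: `v = wilsonPlaqWeight N β`)
and composed with `isGibbsMeasure_groupHeatKernelMeasure` / `wilsonMeasure_eq_groupHeatKernelMeasure`.
NOTHING is certified or asserted: no window system, no array, no value of `β` is claimed to satisfy
(H1)–(H2); no continuum, confinement or mass-gap claim. The cell found NO certificate beyond the
single-link radius (`SU(2)`, `d = 4`: zero-exterior-field received sum of the plaquette window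
`γ₀(0) = (15 + 15β_W/4)·β_W/4`, `= 1` at `β_W ≈ 0.2509`, no certificate format off zero field —
the cell's `CLOSE-DS.md`); these files record what such a certificate would have had to contain.

## Contents
* `linkWeight r` — the cell weight `w x σ τ = r(σ_x, τ_x)` of a weight `r` on the group.
* `IsLinkWindowContraction v r win k` — (H1) in lattice-gauge language: for every centre link `c`,
  every link `y ∉ win c`, ALL pairs of configurations differing only at `y` (every other link value
  arbitrary — the WHOLE exterior field space, not a neighbourhood of the trivial field), every bounded
  measurable `f` of the links of `win c` with per-link Lipschitz constants `δ ≥ 0` for `r`, the window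
  kernels (Haar on the links of `win c`, boundary condition outside, tilted by the plaquette weights)
  satisfy `|γ_{win c}(f | ω) − γ_{win c}(f | η)| ≤ (Σ_{x ∈ win c} k c y x · δ x) · r(ω_y, η_y)`;
  `isLinkWindowContraction_iff` — it is LITERALLY `DSWindow.IsWindowKRContraction` with `cell = id`.
* `Certificate.ofLinkWindows` — the constructor = the cell's certificate format field by field
  (`v` i.e. `β`; `r ≤ R`; `win` with `x ∈ win x` and `≤ N⋆` windows around a link; `k ≥ 0` with (H1);
  `γ₀ ∈ [0, 1)` with (H2) `IsDSReceivedSum`); `LinkObs r f Δ δ` (+ `.obs`) — admissible link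
  observables (bounded measurable, local, per-link Lipschitz for `r`).
* `plaquetteWeight_abs_covariance_le` — DOOR for any compact group and positive continuous plaquette
  weight: certificate ⇒ `|cov(f, g)| ≤ 4 R² e^{−κ₁ L₀} (Σ δf)(Σ δg)` under the plaquette-weight torus
  measure, `κ₁ = (1 − γ₀)²/(2(2γ₀N⋆ + 1))`, constants read from the certificate (uniform in `L`).
* `wilson_abs_covariance_le` — the same for the `SU(N)` Wilson torus measure at tree coupling `β`
  (`β_W = N β`; `SU(2)`: `β = β_W/2`).
* `Certificate.ofOneLinkKRModulus`, `Certificate.su2OfOneLinkKRModulus(_γ₀)` — the windows `{x}`: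
  the tree's single-link door (`OneLinkKRModulus`, `isKRContraction_torusWilson`; for `SU(2)`, `d = 4`
  the J-SC3 schema `OneLinkKRModulusSU2 β_W K₂`, `18 β_W K₂ ≤ c < 1`) IS a window certificate with
  `γ₀ = c` — the owned front in this currency; the lane sought a plaquette-window one beyond it.

NOT here: a certificate instance; the profile for a concrete window system (plaquette windows:
plaquette-graph distance layers scaled by the window diameter; single link: `exists_linkProfile`);
the torus → `ℤ^d` passage (pattern: `plaquetteWeight_torusClustering_dobrushin`).

References: R. L. Dobrushin, S. B. Shlosman (1985), condition `C_V`; H. Föllmer, LNM 1362 (1988)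
Ch. I Thm. (2.13); E. Seiler, LNP 159 (1982) Ch. 2 (DLR structure of lattice gauge theories);
H. Shen, R. Zhu, X. Zhu, CMP 400 (2023) 805–851 (the single-link Dobrushin route, Rem. after Thm. 1.3).
-/

noncomputable section

open MeasureTheory ProbabilityTheory Function
open Literature.Probability.LatticeModels
open Literature.MathematicalPhysics.QuantumLattice (groupHeatKernelMeasure fundamentalRep)
open Literature.MathematicalPhysics.QuantumFieldTheory
open Literature.MathematicalPhysics.QuantumFieldTheory.Balaban1983to89.StrongCouplingTorusWindow
  (wilsonPlaqWeight wilsonMeasure_eq_groupHeatKernelMeasure continuous_wilsonPlaqWeight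
  wilsonPlaqWeight_pos)

namespace Summit.Ventures.YMGap.DSWindow

/-! ### The lattice-gauge dictionary: cells = links of the torus, windows = finite sets of links -/

section LatticeGauge

variable {d L : ℕ} [NeZero L] {G : Type*} [Group G] [TopologicalSpace G] [IsTopologicalGroup G]
  [CompactSpace G] [MeasurableSpace G] [BorelSpace G]

/-- The **link weight** read from a weight `r` on the group: `w x σ τ = r(σ_x, τ_x)`. -/
abbrev linkWeight (r : G → G → ℝ) : Edge d L → GaugeConfig d L G → GaugeConfig d L G → ℝ :=
  fun x σ τ => r (σ x) (τ x)

/-- **(H1) in lattice-gauge language**, for the torus weight specification `torusWeightSpec v` of a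
plaquette weight `v` on the links of `(ℤ/L)^d` (Wilson: `v = wilsonPlaqWeight N β`), a weight `r` on
the group, a window system `win` (a finite set of links around every link) and an influence array
`k`: for every centre link `c`, every link `y ∉ win c`, ALL pairs of configurations `ω, η` that differ
only at the link `y` (every other link value arbitrary), every bounded measurable `f` reading only the
links of `win c` with per-link Lipschitz constants `δ x ≥ 0` for `r`
(`|f σ − f τ| ≤ δ x · r(σ_x, τ_x)` when `σ = τ` off `x`): the window kernels — Haar on the links of
`win c`, boundary condition `ω` resp. `η`, tilted by the plaquette weights — satisfy
`|γ_{win c}(f | ω) − γ_{win c}(f | η)| ≤ (Σ_{x ∈ win c} k c y x · δ x) · r(ω_y, η_y)`.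
Only links `y` sharing a plaquette with a link of `win c` can have `k c y · ≠ 0` (finite range); the
supremum over the common exterior is over the WHOLE exterior field space. -/
def IsLinkWindowContraction (v : G → ℝ) (r : G → G → ℝ) (win : Edge d L → Finset (Edge d L))
    (k : Edge d L → Edge d L → Edge d L → ℝ) : Prop :=
  ∀ (c y : Edge d L), y ∉ win c → ∀ (ω η : GaugeConfig d L G), (∀ e, e ≠ y → ω e = η e) →
    ∀ (f : GaugeConfig d L G → ℝ) (δ : Edge d L → ℝ), Measurable f → (∃ B, ∀ U, |f U| ≤ B) →
      DependsOn f (↑(win c) : Set (Edge d L)) → (∀ x, 0 ≤ δ x) →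
      (∀ (x : Edge d L) (σ τ : GaugeConfig d L G), (∀ e, e ≠ x → σ e = τ e) →
        |f σ - f τ| ≤ δ x * r (σ x) (τ x)) →
        |∫ U, f U ∂(torusWeightSpec v (win c) ω) - ∫ U, f U ∂(torusWeightSpec v (win c) η)| ≤
          (∑ x ∈ win c, k c y x * δ x) * r (ω y) (η y)

/-- The lattice-gauge form of (H1) is LITERALLY the abstract one with cells = links (`cell = id`),
`Λ = win` and the link weight (definitional unfolding). -/
theorem isLinkWindowContraction_iff (v : G → ℝ) (r : G → G → ℝ)
    (win : Edge d L → Finset (Edge d L)) (k : Edge d L → Edge d L → Edge d L → ℝ) :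
    IsLinkWindowContraction v r win k ↔
      IsWindowKRContraction (torusWeightSpec (d := d) (L := L) v) id (linkWeight r) win win k :=
  Iff.rfl

/-- **The lattice-gauge certificate constructor** — the cell's certificate format, field by field:
the plaquette weight `v` (fixes `β`), the group weight `r ≤ R` (e.g. Frobenius distance on `SU(2)`,
`R = 2√2`), the window system `win` with every link in its own window and at most `Nstar` windows
around a link, the nonnegative array `k` with (H1) `IsLinkWindowContraction` valid over the whole
exterior field space, and the received-sum ratio `γ₀ ∈ [0, 1)` with (H2) `IsDSReceivedSum`. The
window kernels of a fixed window shape do not depend on the torus side once the torus is larger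
than the window's plaquette closure, so one analytic certificate serves every `L` with the same
numeric fields — whence volume-uniform constants below. -/
def Certificate.ofLinkWindows (v : G → ℝ) (r : G → G → ℝ) (R : ℝ) (hR : 0 ≤ R)
    (hrR : ∀ a b, r a b ≤ R) (win : Edge d L → Finset (Edge d L)) (hself : ∀ x, x ∈ win x)
    (Nstar : ℕ) (hN : ∀ x, (Finset.univ.filter fun c => x ∈ win c).card ≤ Nstar)
    (k : Edge d L → Edge d L → Edge d L → ℝ) (hk : ∀ c y x, 0 ≤ k c y x)
    (hcontract : IsLinkWindowContraction v r win k) (γ₀ : ℝ) (hγ₀ : 0 ≤ γ₀) (hγ₁ : γ₀ < 1)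
    (hsum : IsDSReceivedSum win k γ₀) :
    Certificate (torusWeightSpec (d := d) (L := L) v) (id : Edge d L → Edge d L) where
  w := linkWeight r
  R := R
  Λ := win
  win := win
  Nstar := Nstar
  k := k
  γ₀ := γ₀
  R_nonneg := hR
  w_le _ _ _ := hrR _ _
  w_local c σ σ' τ τ' hσ hτ := by simp only [linkWeight, hσ c rfl, hτ c rfl]
  mem_iff _ _ := Iff.rfl
  self_mem := hself
  card_le := hN
  k_nonneg := hk
  contract := (isLinkWindowContraction_iff v r win k).1 hcontract
  γ₀_nonneg := hγ₀
  γ₀_lt_one := hγ₁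
  receivedSum := hsum

/-- **An admissible LINK observable** for the group weight `r`: `f` is bounded and measurable,
reads only the links of `Δ`, and `δ x ≥ 0` bounds its variation under a change of the single link
`x` in units of `r` (`|f σ − f τ| ≤ δ x · r(σ_x, τ_x)` when `σ = τ` off `x`). With the Frobenius
distance on `SU(N)` these are the Lipschitz cylinder functions of the tree's clustering statements;
`LinkObs.obs` turns it into `Certificate.Obs` for any certificate whose weight is `linkWeight r`. -/
structure LinkObs (r : G → G → ℝ) (f : GaugeConfig d L G → ℝ) (Δ : Finset (Edge d L))
    (δ : Edge d L → ℝ) : Prop where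
  /-- `f` is measurable -/
  measurable : Measurable f
  /-- `f` is bounded -/
  bounded : ∃ B, ∀ U, |f U| ≤ B
  /-- `f` reads only the links of `Δ` -/
  dependsOn : DependsOn f (↑Δ : Set (Edge d L))
  /-- the per-link Lipschitz constants are nonnegative -/
  nonneg : ∀ x, 0 ≤ δ x
  /-- `δ x` bounds the variation of `f` under a change of the link `x`, in units of `r` -/
  lip : ∀ (x : Edge d L) (σ τ : GaugeConfig d L G), (∀ e, e ≠ x → σ e = τ e) →
    |f σ - f τ| ≤ δ x * r (σ x) (τ x)

omit [Group G] [TopologicalSpace G] [IsTopologicalGroup G] [CompactSpace G] [BorelSpace G] in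
/-- A link observable is admissible for every certificate whose weight is the link weight of `r`. -/
theorem LinkObs.obs {γ : Specification (Edge d L) G} {r : G → G → ℝ}
    (C : Certificate γ (id : Edge d L → Edge d L)) (hw : C.w = linkWeight r)
    {f : GaugeConfig d L G → ℝ} {Δ : Finset (Edge d L)} {δ : Edge d L → ℝ} (h : LinkObs r f Δ δ) :
    C.Obs f Δ δ where
  measurable := h.measurable
  bounded := h.bounded
  dependsOn := h.dependsOn
  nonneg := h.nonneg
  lip x σ τ hστ := by rw [hw]; exact h.lip x σ τ hστ

variable [SecondCountableTopology G] [MeasurableSingletonClass G]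

/-- **Door, lattice-gauge form (any compact group, any positive continuous plaquette weight).** A
window certificate for the torus weight specification of `v` on `(ℤ/L)^d` gives, for the
plaquette-weight measure `Z⁻¹ ∏_q v(U_q) ∏_e dU_e` (a Gibbs measure of that specification,
`isGibbsMeasure_groupHeatKernelMeasure`), admissible observables `f, g` of the links in `Δf, Δg`
and an adapted profile at depth `L₀`: `|cov(f, g)| ≤ 4 R² e^{−κ₁ L₀} (Σ δf)(Σ δg)`, `κ₁ = C.rate` —
constants read from the certificate only (uniform in `L` for a fixed certificate format). -/
theorem plaquetteWeight_abs_covariance_le {v : G → ℝ} (hv : Continuous v) (hv0 : ∀ g, 0 < v g)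
    (C : Certificate (torusWeightSpec (d := d) (L := L) v) (id : Edge d L → Edge d L))
    {f g : GaugeConfig d L G → ℝ} {Δf Δg : Finset (Edge d L)} {δf δg : Edge d L → ℝ}
    (hf : C.Obs f Δf δf) (hg : C.Obs g Δg δg) {ℓ : Edge d L → ℕ} {L₀ : ℕ}
    (hℓ : C.Profile Δf Δg ℓ L₀) :
    |cov[f, g; groupHeatKernelMeasure (d := d) (L := L) (fun _ : ℝ => v) 0]| ≤
      4 * C.R ^ 2 * Real.exp (-(C.rate * L₀)) * (∑ x ∈ Δf, δf x) * ∑ y ∈ Δg, δg y :=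
  C.abs_covariance_le (isSpecification_torusWeightSpec hv hv0)
    (isGibbsMeasure_groupHeatKernelMeasure hv hv0) hf hg hℓ

end LatticeGauge

section Wilson

variable {d L N : ℕ} [NeZero L]

/-- **Door, `SU(N)` Wilson form.** For the torus Wilson measure of `SU(N)` at tree coupling `β`
(plaquette weight `exp(−β(N − Re tr U_q))`, `wilsonMeasure (fundamentalRep (Fin N)) β`; Wilson's
`β_W = N β`, for `SU(2)` `β = β_W/2`), a window certificate for `torusWeightSpec (wilsonPlaqWeight N β)`
gives `|cov(f, g)| ≤ 4 R² e^{−κ₁ L₀} (Σ δf)(Σ δg)` for admissible (link-Lipschitz, bounded measurable,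
local) observables and an adapted profile — the SC-a clustering currency at that `β`, constants read
from the certificate. No certificate is supplied here. -/
theorem wilson_abs_covariance_le (β : ℝ)
    (C : Certificate (torusWeightSpec (d := d) (L := L) (wilsonPlaqWeight N β))
      (id : Edge d L → Edge d L))
    {f g : GaugeConfig d L (Matrix.specialUnitaryGroup (Fin N) ℂ) → ℝ} {Δf Δg : Finset (Edge d L)}
    {δf δg : Edge d L → ℝ} (hf : C.Obs f Δf δf) (hg : C.Obs g Δg δg) {ℓ : Edge d L → ℕ} {L₀ : ℕ}
    (hℓ : C.Profile Δf Δg ℓ L₀) :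
    |cov[f, g; wilsonMeasure (d := d) (L := L) (fundamentalRep (Fin N)) β]| ≤
      4 * C.R ^ 2 * Real.exp (-(C.rate * L₀)) * (∑ x ∈ Δf, δf x) * ∑ y ∈ Δg, δg y := by
  haveI : SecondCountableTopology (Matrix (Fin N) (Fin N) ℂ) :=
    inferInstanceAs (SecondCountableTopology (Fin N → Fin N → ℂ))
  haveI : SecondCountableTopology (Matrix.specialUnitaryGroup (Fin N) ℂ) :=
    Topology.IsEmbedding.subtypeVal.secondCountableTopology
  rw [wilsonMeasure_eq_groupHeatKernelMeasure]
  exact plaquetteWeight_abs_covariance_le (continuous_wilsonPlaqWeight β) (wilsonPlaqWeight_pos β)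
    C hf hg hℓ

end Wilson

/-! ### The windows `{x}`: the tree's single-link door of `SU(N)` Wilson as a window certificate -/

section SingleLink

open Literature.MathematicalPhysics.QuantumFieldTheory.Balaban1983to89.StrongCouplingDobrushinWindow
  (OneLinkKRModulus OneLinkKRModulusSU2)
open Literature.MathematicalPhysics.QuantumFieldTheory.Balaban1983to89.StrongCouplingTorusWindow
  (isKRContraction_torusWilson sum_linkNbrT_wilsonCoeff_le)

variable {d L N : ℕ} [NeZero L]

/-- **The single-link door IS a window certificate (windows `{x}`, `N⋆ = 1`).** For `SU(N)` Wilson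
at tree coupling `β` on `(ℤ/L)^d`, `L ≥ 2`: the one-link Kantorovich–Rubinstein modulus
`OneLinkKRModulus N R K` on the ball `‖B‖_op ≤ R ⊇ (|β|/N)·2(d−1)` (the tree's named hypothesis;
`isKRContraction_torusWilson`) with Dobrushin constant `6(d−1)(|β|/N)K ≤ c < 1` gives the
certificate with weight = Frobenius distance (`R = 2√N`), `γ₀ = c` — `Certificate.ofKRContraction`
run on the torus. This is the cell's OWNED front in window form; track (c) asked for a certificate
of a LARGER window (the plaquette) with `γ₀ < 1` beyond it, and found none. -/
def Certificate.ofOneLinkKRModulus (hd : 1 ≤ d) (hN : 1 ≤ N) (hL : 1 < L) {β R K c : ℝ}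
    (hK : 0 ≤ K) (hR : |β| / N * (2 * ((d : ℝ) - 1)) ≤ R) (hmod : OneLinkKRModulus N R K)
    (hc : 6 * ((d : ℝ) - 1) * (|β| / N) * K ≤ c) (hc0 : 0 ≤ c) (hc1 : c < 1) :
    Certificate (torusWeightSpec (d := d) (L := L) (wilsonPlaqWeight N β))
      (id : Edge d L → Edge d L) := by
  haveI : SecondCountableTopology (Matrix (Fin N) (Fin N) ℂ) :=
    inferInstanceAs (SecondCountableTopology (Fin N → Fin N → ℂ))
  haveI : SecondCountableTopology (Matrix.specialUnitaryGroup (Fin N) ℂ) :=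
    Topology.IsEmbedding.subtypeVal.secondCountableTopology
  exact Certificate.ofKRContraction
    (isSpecification_torusWeightSpec (continuous_wilsonPlaqWeight β) (wilsonPlaqWeight_pos β))
    (isKRContraction_torusWilson hd hN hL hK hR hmod) (R := 2 * Real.sqrt N) (by positivity)
    suFrobDist_le hc0 hc1 fun e => (sum_linkNbrT_wilsonCoeff_le hd hK e).trans hc

/-- **`SU(2)`, `d = 4`, Wilson coupling `β_W ≥ 0`** (tree coupling `β_W/2`, 't Hooft `β_W/4`): the
`SU(2)` modulus schema `OneLinkKRModulusSU2 β_W K₂` (the tree's J-SC3 hypothesis) with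
`18 β_W K₂ ≤ c < 1` gives the `{x}`-window certificate with `γ₀ = c` on every torus `(ℤ/L)^4`,
`L ≥ 2` — the single-link front (`β_W < 2/9`-class) in the window currency of this file. -/
def Certificate.su2OfOneLinkKRModulus (hL : 1 < L) {βW K₂ c : ℝ} (hβ : 0 ≤ βW) (hK : 0 ≤ K₂)
    (hmod : OneLinkKRModulusSU2 βW K₂) (hc : 18 * βW * K₂ ≤ c) (hc0 : 0 ≤ c) (hc1 : c < 1) :
    Certificate (torusWeightSpec (d := 4) (L := L) (wilsonPlaqWeight 2 (βW / 2)))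
      (id : Edge 4 L → Edge 4 L) :=
  Certificate.ofOneLinkKRModulus (d := 4) (N := 2) (by norm_num) (by norm_num) hL (K := 4 * K₂)
    (R := 3 * βW / 2) (by positivity) (by rw [abs_of_nonneg (by positivity)]; push_cast; linarith)
    hmod (by rw [abs_of_nonneg (by positivity)]; push_cast; linarith) hc0 hc1

/-- The received-sum ratio of the `SU(2)` single-link certificate is the Dobrushin constant `c`
(`≥ 18 β_W K₂`). -/
theorem Certificate.su2OfOneLinkKRModulus_γ₀ (hL : 1 < L) {βW K₂ c : ℝ} (hβ : 0 ≤ βW)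
    (hK : 0 ≤ K₂) (hmod : OneLinkKRModulusSU2 βW K₂) (hc : 18 * βW * K₂ ≤ c) (hc0 : 0 ≤ c)
    (hc1 : c < 1) :
    (Certificate.su2OfOneLinkKRModulus hL hβ hK hmod hc hc0 hc1).γ₀ = c := rfl

end SingleLink

end Summit.Ventures.YMGap.DSWindow

end
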